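/-
Origin: expansion seat `planner-pub-hodgecm-pv14-g6-0`, handover import Pv14g6.SchwartzExpFlow -> import HodgeCM.Automorphic.SchwartzExpFlow ; after t31 row 13 (SchwartzExpFlow) (`HOME/pub-hodgecm-pv14-g6/lean/Pv14g6/SchwartzExpFlowDilation.lean`, md5 04ffcdc9, 48 lines);
landed by the gen-8 packager in gate run 31 as `HodgeCM/Automorphic/SchwartzExpFlowDilation.lean` (import ^import Pv14g6\.SchwartzExpFlow[ \t]*$→import HodgeCM.Automorphic.SchwartzExpFlow ×1).
-/
/-
Copyright: HodgeCM public adjudication package, seat pub-hodgecm-pv14-g6 (DAG-NODE PROVER #14, gen 6).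
File #31 of this seat.  Kernel-checked, no new axioms.  Imports file #28 of this seat (hence #16) and Mathlib.
-/
import Summits.HodgeConjecture.HodgeCM.Automorphic.SchwartzExpFlow

/-!
# `exp(s · 1) = e^s · 1`: the dilation flow of file #16 IS the exponential flow of the identity

`expFlow_one_eq_dilation : expFlow (1 : E →L[ℝ] E) = dilation E`, so the dilation clauses of file #16
(`x ↦ e^s x`, Euler operator) are the `A = 1` instances of the `exp(sA)` clauses of files #28/#29.

Only published mathematics is used (Mathlib); nothing here refers to the objects under adjudication.
-/

noncomputable section

namespace HodgeCM
namespace SchwartzWeil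

section ExpDilation

variable (E : Type*) [NormedAddCommGroup E] [NormedSpace ℝ E]

/-- `exp(s · 1) = e^s · 1` in the operator algebra. -/
theorem exp_smul_one_eq (s : ℝ) :
    NormedSpace.exp (s • (1 : E →L[ℝ] E)) = Real.exp s • (1 : E →L[ℝ] E) := by
  rw [← Algebra.algebraMap_eq_smul_one, ← NormedSpace.algebraMap_exp_comm,
    Algebra.algebraMap_eq_smul_one, Real.exp_eq_exp_ℝ]

variable [CompleteSpace E]

/-- **The exponential flow of the identity is the dilation flow** `x ↦ e^s x` of file #16. -/
theorem expFlow_one_eq_dilation : expFlow (1 : E →L[ℝ] E) = dilation E :=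
  (eq_expFlow_of_coe_eq (A := (1 : E →L[ℝ] E)) (g := dilation E)
    fun s => by rw [coe_dilation, exp_smul_one_eq]).symm

/-- (Ported verbatim from the HodgeCMPerL package; no docstring in the source.) -/
theorem expFlow_one_apply (s : ℝ) (x : E) : expFlow (1 : E →L[ℝ] E) s x = Real.exp s • x := by
  rw [expFlow_one_eq_dilation, dilation_apply]

/-- (Ported verbatim from the HodgeCMPerL package; no docstring in the source.) -/
theorem coe_expFlow_one (s : ℝ) :
    ((expFlow (1 : E →L[ℝ] E) s : E ≃L[ℝ] E) : E →L[ℝ] E) = Real.exp s • 1 := by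
  rw [expFlow_one_eq_dilation, coe_dilation]

end ExpDilation

end SchwartzWeil
end HodgeCM
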